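import Summits.SmoothPoincare4.SmoothPoincare4.Theorems.ConvexBisectionAcyclicBisectionExistsDualHandleSeamModelChart
import Summits.SmoothPoincare4.SmoothPoincare4.Theorems.ConvexBisectionAcyclicBisectionExistsBeltPageLimit
import Summits.SmoothPoincare4.SmoothPoincare4.Theorems.ConvexBisectionAcyclicBisectionExistsDualHandleModelMap
import Summits.SmoothPoincare4.SmoothPoincare4.Theorems.ConvexBisectionAcyclicBisectionExistsHgapTwistModel
import HarnessLib

/-!
# Hgap ▸ part B (page twisting of the straightened dual framed knot), brick G2-1 (gluing side):
# the belt tube is glued to the attaching tube with core angle and fibre direction EXCHANGED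
(wave 6, crux stmt-SmoothPoincare4-10508, line `modp-braid-orbits`, stub `stub_T3_dualPresentation` (T3)
▸ node `Hgap` ▸ part B `helper_Hgap_twisting`; registered sub-goal `helper_belt_boundaryTube_glued`)

The belt tube of the `j`-th handle is the boundary tube `β♭ = (beltMap D j).boundaryTube` of its belt
map (`…DualHandleBeltMap.lean`): `β♭ (θ, m) = jB_j (σ (depthLine θ m 0))`, the sphere point
`(x_λ, x_μ) = (m, √(1 - ‖m‖²) θ)` near the belt circle `B = {x_λ = 0}` (core `m = 0`).  For `m = r v`,
`0 < r < 1`, `v ∈ S¹`, Kosinski's inversion `α` sends it to the tube point of CORE ANGLE `v` and FIBRE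
VECTOR `r θ`: `α (r v, √(1-r²) θ) = (√(1-r²) v, r θ) = depthLine v (r θ) 0` (§1,
`handleInversion_mkVec_polar`: core parameter and normal direction are exchanged), so by Kosinski's
identification (`jA_apply_eq_jB`)

    β♭ (θ, r v) = jA (f♭ (v, r θ)),      f♭ = (h j).boundaryTube      (§2, `coe_belt_boundaryTube_polar`).

Consequently (§3), for a fibred model `(D, bX, Ψ)` with the page clause, the seam push of the belt
tube point is a POSITIVE MULTIPLE, at the level of `w`, of the attaching-tube point with exchanged
coordinates (`w_seamDiffeo_belt_boundaryTube`, registered `helper_belt_boundaryTube_glued`), and the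
PAGE SLOPE of the pushed (and fibred-straightened) belt tube point equals that of `f♭ (v, r θ)`
(`pageSlope_seam_belt_eq`): along the radial arc `r ↦ (θ, r v)` of the belt tube through the belt circle
the boundary open book of `X` is read, to first order, by the fibre derivative of the page slope of
`f♭` at the core point `v` in the fibre direction `θ` (`helper_pageSlope_fibreDeriv`,
`…HgapTwistModel.lean`).

Everything is proved; no named facts, no `sorry`.  References: A. A. Kosinski, *Differential
Manifolds* (1993), VI §6 (6.1) [Kosinski1993]; J. Milnor, *Lectures on the h-cobordism theorem*
(1965), §3 [MilnorHCobordism1965].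
-/

noncomputable section

set_option linter.dupNamespace false

open scoped Manifold ContDiff Topology ComplexConjugate
open Set Function Metric Complex
open Literature.Topology.FourManifolds Literature.Topology.FourManifolds.HandleAttachingMap
  Literature.Topology.FourManifolds.LefschetzBase

namespace Summit.SmoothPoincare4.SmoothPoincare4.Theorems.AcyclicBisectionExists.ModpBraidOrbits

/-! ## §1 Kosinski's inversion on the sphere exchanges core angle and fibre direction -/

/-- The fibre condition of the radial tube points: `0 < 1 - 0 - ‖r u‖²` for a unit `u` and `r < 1`,
`0 ≤ r`… in fact for `r² < 1`. [folklore] -/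
theorem radial_fibre_cond (u : sphere (0 : EuclideanSpace ℝ (Fin 2)) 1) {r : ℝ} (hr0 : 0 ≤ r) (hr1 : r < 1) :
    0 < 1 - 0 - ‖r • (u : EuclideanSpace ℝ (Fin 2))‖ ^ 2 := by
  rw [norm_smul, Real.norm_eq_abs, abs_of_nonneg hr0, norm_eq_of_mem_sphere u, mul_one]
  nlinarith

/-- **`α (depthLine v (r θ) 0) = σ (depthLine θ (r v) 0)` as vectors**: Kosinski's inversion sends the
tube point of core angle `v` and fibre vector `r θ` (`0 < r < 1`) to the block swap of the tube point
of core angle `θ` and fibre vector `r v` — the sphere point `(r v, √(1-r²) θ)` near the belt circle.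
[cite: Kosinski1993, VI (6.1)] -/
theorem handleInversion_mkVec_polar (v θ : sphere (0 : EuclideanSpace ℝ (Fin 2)) 1) {r : ℝ}
    (hr0 : 0 < r) (hr1 : r < 1) :
    handleInversion 2 (mkVec (v : EuclideanSpace ℝ (Fin 2)) (r • (θ : EuclideanSpace ℝ (Fin 2))) 0) =
      swapIso (mkVec (θ : EuclideanSpace ℝ (Fin 2)) (r • (v : EuclideanSpace ℝ (Fin 2))) 0) := by
  have hθ := radial_fibre_cond θ hr0.le hr1
  have hv := radial_fibre_cond v hr0.le hr1
  have hrθ : ‖r • (θ : EuclideanSpace ℝ (Fin 2))‖ ^ 2 = r ^ 2 := by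
    rw [norm_smul, Real.norm_eq_abs, abs_of_nonneg hr0.le, norm_eq_of_mem_sphere θ, mul_one]
  have hrv : ‖r • (v : EuclideanSpace ℝ (Fin 2))‖ ^ 2 = r ^ 2 := by
    rw [norm_smul, Real.norm_eq_abs, abs_of_nonneg hr0.le, norm_eq_of_mem_sphere v, mul_one]
  set x := mkVec (v : EuclideanSpace ℝ (Fin 2)) (r • (θ : EuclideanSpace ℝ (Fin 2))) 0 with hx
  have hls : lamSq 2 x = 1 - r ^ 2 := by rw [hx, lamSq_mkVec v _ hθ.le, hrθ]; ring
  have hsq1 : Real.sqrt (1 - lamSq 2 x) = r := by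
    rw [hls, show 1 - (1 - r ^ 2) = r ^ 2 by ring, Real.sqrt_sq hr0.le]
  have hsq2 : Real.sqrt (1 - 0 - ‖r • (θ : EuclideanSpace ℝ (Fin 2))‖ ^ 2) = Real.sqrt (1 - r ^ 2) := by
    rw [hrθ]; ring_nf
  have hsq3 : Real.sqrt (1 - 0 - ‖r • (v : EuclideanSpace ℝ (Fin 2))‖ ^ 2) = Real.sqrt (1 - r ^ 2) := by
    rw [hrv]; ring_nf
  have hspos : 0 < Real.sqrt (1 - r ^ 2) := Real.sqrt_pos.2 (by nlinarith)
  -- compare `λ`- and `μ`-parts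
  have hlam : lamPart (handleInversion 2 x) = r • (v : EuclideanSpace ℝ (Fin 2)) := by
    rw [lamPart_handleInversion, hsq1, hls, hx, lamPart_mkVec, hsq2, smul_smul,
      div_mul_cancel₀ _ hspos.ne']
  have hmu : muPart (handleInversion 2 x) = Real.sqrt (1 - r ^ 2) • (θ : EuclideanSpace ℝ (Fin 2)) := by
    rw [muPart_handleInversion, hsq1, hls, hx, muPart_mkVec, smul_smul, div_mul_cancel₀ _ hr0.ne']
  have hlam' : lamPart (swapIso (mkVec (θ : EuclideanSpace ℝ (Fin 2)) (r • (v : EuclideanSpace ℝ (Fin 2))) 0)) =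
      r • (v : EuclideanSpace ℝ (Fin 2)) := by
    rw [mkVec, map_add, map_smul, swapIso_lamEmbed, swapIso_muEmbed, lamPart_add, lamPart_smul,
      lamPart_muEmbed, lamPart_lamEmbed, smul_zero, zero_add]
  have hmu' : muPart (swapIso (mkVec (θ : EuclideanSpace ℝ (Fin 2)) (r • (v : EuclideanSpace ℝ (Fin 2))) 0)) =
      Real.sqrt (1 - r ^ 2) • (θ : EuclideanSpace ℝ (Fin 2)) := by
    rw [mkVec, map_add, map_smul, swapIso_lamEmbed, swapIso_muEmbed, muPart_add, muPart_smul,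
      muPart_muEmbed, muPart_lamEmbed, add_zero, hsq3]
  rw [← lamEmbed_add_muEmbed (handleInversion 2 x), hlam, hmu,
    ← lamEmbed_add_muEmbed (swapIso (mkVec (θ : EuclideanSpace ℝ (Fin 2)) (r • (v : EuclideanSpace ℝ (Fin 2))) 0)),
    hlam', hmu']

/-! ## §2 The belt tube point is glued to the attaching tube point with exchanged coordinates -/

section Glue

variable {B : Type} [TopologicalSpace B] [T2Space B] [ChartedSpace (EuclideanHalfSpace 4) B]
  {ι : Type} [Finite ι] {h : ι → HandleAttachingMap 3 2 B}
  {X : Type} [TopologicalSpace X] [ChartedSpace (EuclideanHalfSpace 4) X] [IsManifold (𝓡∂ 4) ∞ X]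

/-- The radial attaching-tube point `depthLine v (r θ) 0` (`0 < r < 1`) is off the attaching sphere
(`|x_λ|² = 1 - r² ≠ 1`). [folklore] -/
theorem lamSq_depthLine_radial_ne_one (v θ : sphere (0 : EuclideanSpace ℝ (Fin 2)) 1) {r : ℝ}
    (hr0 : 0 < r) (hr1 : r < 1) :
    lamSq 2 (((depthLine v (r • (θ : EuclideanSpace ℝ (Fin 2))) 0 : ↥(handleTube 3 2)) :
      closedBall (0 : EuclideanSpace ℝ (Fin 4)) 1) : EuclideanSpace ℝ (Fin 4)) ≠ 1 := by
  have hθ := radial_fibre_cond θ hr0.le hr1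
  have e : lamSq 2 (((depthLine v (r • (θ : EuclideanSpace ℝ (Fin 2))) 0 : ↥(handleTube 3 2)) :
      closedBall (0 : EuclideanSpace ℝ (Fin 4)) 1) : EuclideanSpace ℝ (Fin 4)) = 1 - r ^ 2 := by
    have := lamSq_depthLine v (r • (θ : EuclideanSpace ℝ (Fin 2))) le_rfl hθ
    rw [norm_smul, Real.norm_eq_abs, abs_of_nonneg hr0.le, norm_eq_of_mem_sphere θ, mul_one] at this
    show lamSq 2 (tubeVec (depthLine v (r • (θ : EuclideanSpace ℝ (Fin 2))) 0)) = 1 - r ^ 2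
    rw [this]; ring
  rw [e]
  nlinarith

/-- **The belt tube point over the glued region is the attaching tube point with exchanged
coordinates**: `β♭ (θ, r v) = jA (h̄_j (depthLine v (r θ) 0))` for `0 < r < 1`
(`β♭ = (beltMap D j).boundaryTube`; Kosinski's identification `jB (α t) = jA (h̄ t)` at
`t = depthLine v (r θ) 0`, `α t = σ (depthLine θ (r v) 0)`). [cite: Kosinski1993, VI §6] -/
theorem coe_belt_boundaryTube_polar (D : MultiAttachmentData h (𝓡∂ 4) X) (j : ι)
    (v θ : sphere (0 : EuclideanSpace ℝ (Fin 2)) 1) {r : ℝ} (hr0 : 0 < r) (hr1 : r < 1) :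
    (((beltMap D j).boundaryTube.toHomeo (θ, r • (v : EuclideanSpace ℝ (Fin 2))) :
        ↥((𝓡∂ 4).boundary X)) : X) =
      D.jA ⟨(h j).toFun (depthLine v (r • (θ : EuclideanSpace ℝ (Fin 2))) 0),
        BeltPageClause.apply_mem_coresComplement_of_lamSq_ne_one D.disjoint j _
          (lamSq_depthLine_radial_ne_one v θ hr0 hr1)⟩ := by
  rw [BeltPageClause.jA_apply_eq_jB D j _ (lamSq_depthLine_radial_ne_one v θ hr0 hr1),
    HandleAttachingMap.coe_boundaryTube_apply, beltMap_apply]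
  congr 1
  apply Subtype.ext
  apply Subtype.ext
  rw [coe_coe_swapTube]
  show swapIso (tubeVec (depthLine θ (r • (v : EuclideanSpace ℝ (Fin 2))) 0)) =
    handleInversion 2 (tubeVec (depthLine v (r • (θ : EuclideanSpace ℝ (Fin 2))) 0))
  rw [tubeVec_depthLine θ _ le_rfl (radial_fibre_cond v hr0.le hr1),
    tubeVec_depthLine v _ le_rfl (radial_fibre_cond θ hr0.le hr1), handleInversion_mkVec_polar v θ hr0 hr1]

end Glue

/-! ## §3 Through the seam: the page clause and the page slope along the belt tube -/

section Seam

variable {g : ℕ} {ι : Type} [Finite ι] {h : ι → HandleAttachingMap 3 2 (Base g)}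
  {X : Type} [TopologicalSpace X] [ChartedSpace (EuclideanHalfSpace 4) X] [IsManifold (𝓡∂ 4) ∞ X]
  (D : MultiAttachmentData h (𝓡∂ 4) X) (bX : BoundaryData (𝓡∂ 4) X (𝓡 3))
  (Ψ : bX.carrier ≃ₘ⟮𝓡 3, 𝓡 3⟯ (bBase g).carrier)

/-- **The page clause along the belt tube**: for a fibred model with the page clause
(`w (Ψ y) = c · w a`, `c > 0`, whenever `bX.incl y = D.jA a`), the seam push of the belt tube point
`β♭ (θ, r v)` (`0 < r < 1`) has `w = c · w (h̄_j (depthLine v (r θ) 0))` with `c > 0`.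
[cite: Kosinski1993, VI §6] -/
theorem w_seamDiffeo_belt_boundaryTube
    (hpage : ∀ (y : bX.carrier) (a : ↥(coresComplement h)), bX.incl y = D.jA a →
      ∃ c : ℝ, 0 < c ∧ w g ((bBase g).incl (Ψ y)).1 = (c : ℂ) * w g (a : Base g).1)
    (j : ι) (v θ : sphere (0 : EuclideanSpace ℝ (Fin 2)) 1) {r : ℝ} (hr0 : 0 < r) (hr1 : r < 1) :
    ∃ c : ℝ, 0 < c ∧
      w g ((BoundaryManifold.boundaryData 3 (Base g)).incl (seamDiffeo bX (bBase g) Ψ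
          ((beltMap D j).boundaryTube.toHomeo (θ, r • (v : EuclideanSpace ℝ (Fin 2)))))).1 =
        (c : ℂ) * w g ((h j).toFun (depthLine v (r • (θ : EuclideanSpace ℝ (Fin 2))) 0)).1 := by
  set y := (beltMap D j).boundaryTube.toHomeo (θ, r • (v : EuclideanSpace ℝ (Fin 2))) with hy
  set z := (BoundaryManifold.boundaryData 3 X).restrictDiffeomorph bX (Diffeomorph.refl (𝓡∂ 4) X ∞) y
    with hz
  have hz' : bX.incl z = D.jA ⟨(h j).toFun (depthLine v (r • (θ : EuclideanSpace ℝ (Fin 2))) 0),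
      BeltPageClause.apply_mem_coresComplement_of_lamSq_ne_one D.disjoint j _ (lamSq_depthLine_radial_ne_one v θ hr0 hr1)⟩ := by
    rw [hz, incl_restrict_refl, BoundaryManifold.boundaryData_incl]
    exact coe_belt_boundaryTube_polar D j v θ hr0 hr1
  obtain ⟨c, hc, hcw⟩ := hpage z _ hz'
  refine ⟨c, hc, ?_⟩
  have e : (BoundaryManifold.boundaryData 3 (Base g)).incl (seamDiffeo bX (bBase g) Ψ y) =
      (bBase g).incl (Ψ z) := coe_seamDiffeo bX (bBase g) Ψ y
  rw [e]
  exact hcw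

/-- **Sub-goal `helper_belt_boundaryTube_glued` of stub `stub_T3_dualPresentation`** (T3 ▸ node `Hgap` ▸
part B `helper_Hgap_twisting`, brick G2-1 gluing side; wave 6, lead c5): under the page clause, the seam
push of the belt tube point `(beltMap D j)♭ (θ, r v)` has `w = c · w (h̄_j (depthLine v (r θ) 0))`,
`c > 0` (core angle and fibre direction EXCHANGED). [cite: Kosinski1993, VI §6] -/
theorem helper_belt_boundaryTube_glued : ∀ (g : ℕ) (ι : Type) [Finite ι] (h : ι → Literature.Topology.FourManifolds.HandleAttachingMap 3 2 (Literature.Topology.FourManifolds.LefschetzBase.Base g)) (X : Type) [TopologicalSpace X] [ChartedSpace (EuclideanHalfSpace 4) X] [IsManifold (𝓡∂ 4) ∞ X] (D : Literature.Topology.FourManifolds.HandleAttachingMap.MultiAttachmentData h (𝓡∂ 4) X) (bX : Literature.Topology.FourManifolds.BoundaryData (𝓡∂ 4) X (𝓡 3)) (Ψ : bX.carrier ≃ₘ⟮𝓡 3, 𝓡 3⟯ (Literature.Topology.FourManifolds.LefschetzBase.bBase g).carrier), (∀ (y : bX.carrier) (a : ↥(Literature.Topology.FourManifolds.HandleAttachingMap.coresComplement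 h)), bX.incl y = D.jA a → ∃ c : ℝ, 0 < c ∧ Literature.Topology.FourManifolds.LefschetzBase.w g ((Literature.Topology.FourManifolds.LefschetzBase.bBase g).incl (Ψ y)).1 = (c : ℂ) * Literature.Topology.FourManifolds.LefschetzBase.w g (a : Literature.Topology.FourManifolds.LefschetzBase.Base g).1) → ∀ (j : ι) (v θ : Metric.sphere (0 : EuclideanSpace ℝ (Fin 2)) 1) (r : ℝ), 0 < r → r < 1 → ∃ c : ℝ, 0 < c ∧ Literature.Topology.FourManifolds.LefschetzBase.w g ((Literature.Topology.FourManifolds.BoundaryManifold.boundaryData 3 (Literature.Topology.FourManifolds.LefschetzBase.Base g)).incl (Summit.SmoothPoincare4.SmoothPoincare4.Theorems.AcyclicBisectionExists.ModpBraidOrbits.seamDiffeo bX (Literature.Topology.FourManifolds.LefschetzBase.bBase g) Ψ ((Summit.SmoothPoincare4.SmoothPoincare4.Theorems.AcyclicBisectionExists.ModpBraidOrbits.beltMap D j).boundaryTube.toHomeo (θ, r • (v : EuclideanSpace ℝ (Fin 2)))))).1 = (c : ℂ) * Literature.Topology.FourManifolds.LefschetzBase.w g ((h j).toFun (Literature.Topology.FourManifolds.depthLine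 v (r • (θ : EuclideanSpace ℝ (Fin 2))) 0)).1 :=
  fun _ _ _ _ _ _ _ _ D bX Ψ hpage j v θ _ hr0 hr1 =>
    w_seamDiffeo_belt_boundaryTube D bX Ψ hpage j v θ hr0 hr1

/-- **The page slope of the straightened pushed belt tube point is that of the attaching tube point**:
for ANY map `R₁ : Base g → Base g` rescaling `w` positively (the time-1 map of a fibred isotopy) and
any unit direction `c`,
`S_c (w (R₁ (seam (β♭ (θ, r v))))) = S_c (w (h̄_j (depthLine v (r θ) 0)))`, `S_c z = Im (c̄ z)/Re (c̄ z)`.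
[cite: Kosinski1993, VI §6] -/
theorem pageSlope_seam_belt_eq
    (hpage : ∀ (y : bX.carrier) (a : ↥(coresComplement h)), bX.incl y = D.jA a →
      ∃ c : ℝ, 0 < c ∧ w g ((bBase g).incl (Ψ y)).1 = (c : ℂ) * w g (a : Base g).1)
    {R₁ : Base g → Base g} (hR : ∀ x : Base g, ∃ t : ℝ, 0 < t ∧ w g (R₁ x).1 = (t : ℂ) * w g x.1)
    (c : ℂ) (j : ι) (v θ : sphere (0 : EuclideanSpace ℝ (Fin 2)) 1) {r : ℝ} (hr0 : 0 < r) (hr1 : r < 1) :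
    (conj c * w g (R₁ ((BoundaryManifold.boundaryData 3 (Base g)).incl (seamDiffeo bX (bBase g) Ψ
          ((beltMap D j).boundaryTube.toHomeo (θ, r • (v : EuclideanSpace ℝ (Fin 2))))))).1).im /
      (conj c * w g (R₁ ((BoundaryManifold.boundaryData 3 (Base g)).incl (seamDiffeo bX (bBase g) Ψ
          ((beltMap D j).boundaryTube.toHomeo (θ, r • (v : EuclideanSpace ℝ (Fin 2))))))).1).re =
    (conj c * w g ((h j).toFun (depthLine v (r • (θ : EuclideanSpace ℝ (Fin 2))) 0)).1).im /
      (conj c * w g ((h j).toFun (depthLine v (r • (θ : EuclideanSpace ℝ (Fin 2))) 0)).1).re := by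
  obtain ⟨c₁, hc₁, h₁⟩ := w_seamDiffeo_belt_boundaryTube D bX Ψ hpage j v θ hr0 hr1
  obtain ⟨t, ht, h₂⟩ := hR ((BoundaryManifold.boundaryData 3 (Base g)).incl (seamDiffeo bX (bBase g) Ψ
    ((beltMap D j).boundaryTube.toHomeo (θ, r • (v : EuclideanSpace ℝ (Fin 2))))))
  rw [h₂, h₁, pageSlope_smul _ _ ht.ne', pageSlope_smul _ _ hc₁.ne']

end Seam

end Summit.SmoothPoincare4.SmoothPoincare4.Theorems.AcyclicBisectionExists.ModpBraidOrbits

end
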